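import Mathlib.MeasureTheory.Integral.Prod
import Mathlib.MeasureTheory.Integral.MeanInequalities
import Literature.MathematicalPhysics.QuantumLattice.OSPolynomialPositivity
import Literature.MathematicalPhysics.QuantumLattice.OSContractionSemigroup
import Literature.MathematicalPhysics.QuantumLattice.OSAxiomsMeasureProofs
import Literature.MathematicalPhysics.QuantumLattice.SchwartzTranslationCutoff
import HarnessLib

/-!
# Time clustering of field polynomials of an OS measure (Glimm–Jaffe Thm 19.7.1)

Trunk **T-AQFT** (support file for the E4 bridge `IsSchwingerFamilyOf.hasClusterProperty` of
`Literature.MathematicalPhysics.QuantumLattice.SchwingerOSAxioms`), families `constructive-qft`,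
`crit-ising`.

For a measure `μ` on `𝒮'(ℝ^d)` satisfying the Osterwalder–Schrader axioms OS0–OS4
(`IsOSMeasure`), this file proves the **time-cluster property of the polynomial correlations**:
for formal polynomials `v, w` in positive-time fields (`OSPoly d`: finite `ℂ`-combinations of
monomials `∏ⱼ φ(fⱼ)`, `fⱼ ∈ 𝒮₊(ℝ^d)` real), with `P_v(ω) = ∑ v ∏ⱼ ω(fⱼ)` and the OS form
`b(v, w) = ∫ conj (P_v(θω)) P_w(ω) dμ(ω)` (Glimm–Jaffe (6.1.11)),

  `b(v, T_t w) → conj (∫ P_v ∘ Θ dμ) · ∫ P_w dμ`  as `t → +∞`   (`tendsto_polyForm_polyShift`),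

where `T_t` translates every test function forward in time by `t`. This is Glimm–Jaffe's
Thm 19.7.1 ("OS4 ⇒ `e^{-tH} → P_Ω`") in measure-level form, proved along the printed lines:

* `(OSPoly, b)` is a pre-Hilbert space (positivity of `b` is OS3 for polynomials,
  `IsOS3ReflectionPositive.fieldPolynomial_nonneg` from `OSPolynomialPositivity`; Hermitian
  symmetry from `Θ`-invariance of `μ`), on which `T_t` is a symmetric semigroup with bounded
  orbits (time-translation invariance of `μ`, `θ T_t = T_{-t} θ`), so every matrix element
  `b(v, T_t w)` converges (`exists_tendsto_form_semigroup`, from the tree's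
  `exists_tendsto_inner_semigroup`, GJ Thm 6.1.3 (iii) and p. 315);
* the limit is identified through its Cesàro means (`tendsto_inv_smul_intervalIntegral`): by
  Fubini these are `∫ conj (A_T(ω)) P_w(ω) dμ` with `A_T` the time average of `P_v ∘ Θ` along the
  flow, and `A_T → ∫ P_v ∘ Θ dμ` in `L²(dμ)` is exactly OS4 (`IsOS4Ergodic`, GJ (6.1.5)).

The passage from these polynomial correlations to the Schwinger functions `𝔖ₙ₊ₘ(Θf* ⊗ g_{(ta,1)})`
of E4 (density of positive-time tensor products, uniform `L²` bounds, Euclidean covariance to turn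
the spatial direction `a` into the time direction) is carried out in `SchwingerOSCluster`.

## Sources

* J. Glimm, A. Jaffe, *Quantum Physics: a functional integral point of view* (2nd ed. 1987),
  §6.1 (OS3 (6.1.4), OS4 (6.1.5), the form `b` (6.1.11), Thm 6.1.3) and Thm 19.7.1 with its
  proof (pp. 314–315). [GlimmJaffeQP1987]
* K. Osterwalder, R. Schrader, *Axioms for Euclidean Green's functions*, Comm. Math. Phys. 31
  (1973) 83–112, §3 (E4) and Remark 2 (p. 89). [OsterwalderSchraderCMP1973]

## Mathlib

Used: `PreInnerProductSpace.Core` / `InnerProductSpace.ofCore` (to feed the abstract semigroup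
lemma without a global instance), `Finsupp.linearCombination` / `Finsupp.lmapDomain` (formal
polynomials and their time translation), `MeasureTheory.integral_integral_swap` (Fubini),
`ENNReal.lintegral_mul_le_Lp_mul_Lq` / `integral_mul_le_Lp_mul_Lq_of_nonneg` (Cauchy–Schwarz),
`stronglyMeasurable_uncurry_of_continuous_of_stronglyMeasurable`. Absent at the pin: mean-ergodic
or clustering statements for measure-preserving flows in `L²` form usable here.
-/

open scoped SchwartzMap ComplexConjugate InnerProductSpace ENNReal
open MeasureTheory Filter Topology Complex Set

noncomputable section

namespace Literature.MathematicalPhysics.QuantumLattice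

variable {d : ℕ} [NeZero d]

/-! ### Generalities: invariance of integrals, Cauchy–Schwarz -/

section General

variable {α : Type*} [MeasurableSpace α] {μ : Measure α}

/-- Change of variables under a measure-preserving self-map: `∫ g ∘ T dμ = ∫ g dμ` if
`T_* μ = μ`. [folklore] -/
theorem integral_comp_eq_of_map_eq {T : α → α} (hT : Measurable T) (hμT : μ.map T = μ)
    {E : Type*} [NormedAddCommGroup E] [NormedSpace ℝ E]
    {g : α → E} (hg : AEStronglyMeasurable g μ) : ∫ x, g (T x) ∂μ = ∫ x, g x ∂μ := by
  rw [← integral_map hT.aemeasurable (by rwa [hμT]), hμT]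

/-- `MemLp` is preserved by composition with a measure-preserving self-map. [folklore] -/
theorem memLp_comp_of_map_eq {T : α → α} (hT : Measurable T) (hμT : μ.map T = μ)
    {g : α → ℂ} {p : ℝ≥0∞} (hg : MemLp g p μ) : MemLp (fun x => g (T x)) p μ := by
  have hg' : MemLp g p (μ.map T) := hμT.symm ▸ hg
  exact hg'.comp_of_map hT.aemeasurable

/-- Cauchy–Schwarz for two square-integrable scalar functions:
`∫ ‖A‖ ‖B‖ ≤ √(∫ ‖A‖²) √(∫ ‖B‖²)`. [folklore] -/
theorem integral_norm_mul_norm_le_sqrt {A B : α → ℂ} (hA : MemLp A 2 μ) (hB : MemLp B 2 μ) :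
    ∫ x, ‖A x‖ * ‖B x‖ ∂μ ≤ √(∫ x, ‖A x‖ ^ 2 ∂μ) * √(∫ x, ‖B x‖ ^ 2 ∂μ) := by
  have h2 : ENNReal.ofReal 2 = 2 := by norm_num
  have hA' : MemLp (fun x => ‖A x‖) (ENNReal.ofReal 2) μ := by rw [h2]; exact hA.norm
  have hB' : MemLp (fun x => ‖B x‖) (ENNReal.ofReal 2) μ := by rw [h2]; exact hB.norm
  have h := integral_mul_le_Lp_mul_Lq_of_nonneg Real.HolderConjugate.two_two
    (ae_of_all _ fun x => norm_nonneg (A x)) (ae_of_all _ fun x => norm_nonneg (B x)) hA' hB'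
  simp only [Real.rpow_two] at h
  rw [Real.sqrt_eq_rpow, Real.sqrt_eq_rpow]
  exact h

/-- Cauchy–Schwarz: `‖∫ A B‖ ≤ √(∫ ‖A‖²) √(∫ ‖B‖²)`. [folklore] -/
theorem norm_integral_mul_le_sqrt {A B : α → ℂ} (hA : MemLp A 2 μ) (hB : MemLp B 2 μ) :
    ‖∫ x, A x * B x ∂μ‖ ≤ √(∫ x, ‖A x‖ ^ 2 ∂μ) * √(∫ x, ‖B x‖ ^ 2 ∂μ) := by
  refine (norm_integral_le_integral_norm _).trans ?_
  simp only [norm_mul]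
  exact integral_norm_mul_norm_le_sqrt hA hB

/-- Hölder in `ℝ≥0∞` form: `‖∫ A B‖ₑ ≤ ‖A‖_{L²} ‖B‖_{L²}` (no finiteness needed). [folklore] -/
theorem enorm_integral_mul_le_eLpNorm {A B : α → ℂ} (hA : AEStronglyMeasurable A μ)
    (hB : AEStronglyMeasurable B μ) :
    ‖∫ x, A x * B x ∂μ‖ₑ ≤ eLpNorm A 2 μ * eLpNorm B 2 μ := by
  refine (enorm_integral_le_lintegral_enorm _).trans ?_
  simp only [enorm_mul]
  have h := ENNReal.lintegral_mul_le_Lp_mul_Lq μ Real.HolderConjugate.two_two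
    hA.enorm hB.enorm
  rw [eLpNorm_eq_lintegral_rpow_enorm_toReal (by norm_num) (by norm_num),
    eLpNorm_eq_lintegral_rpow_enorm_toReal (by norm_num) (by norm_num)]
  simpa using h

end General


/-! ### A symmetric semigroup with bounded orbits for a positive sesquilinear form -/

section FormSemigroup

/-- `exists_tendsto_inner_semigroup` (Glimm–Jaffe Thm 6.1.3 (iii) and p. 315) restated for an
explicit positive-semidefinite Hermitian form `ip` on a complex vector space, without installing
a (semi)norm instance: for a semigroup `S t` (`t ≥ 0`) of `ip`-symmetric linear maps with
`ip`-bounded orbits, every matrix element `t ↦ ip v (S t w)` converges as `t → +∞`.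
[cite: GlimmJaffeQP1987, Thm 6.1.3 (iii) and Thm 19.7.1 (proof)] -/
theorem exists_tendsto_form_semigroup {V : Type*} [AddCommGroup V] [Module ℂ V]
    (ip : V → V → ℂ) (h_conj : ∀ x y, conj (ip y x) = ip x y)
    (h_nonneg : ∀ x, 0 ≤ (ip x x).re) (h_add : ∀ x y z, ip (x + y) z = ip x z + ip y z)
    (h_smul : ∀ (x y : V) (r : ℂ), ip (r • x) y = conj r * ip x y)
    (S : ℝ → V →ₗ[ℂ] V) (hS : ∀ s t : ℝ, 0 ≤ s → 0 ≤ t → S (s + t) = S s ∘ₗ S t)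
    (hsymm : ∀ t : ℝ, 0 ≤ t → ∀ v w : V, ip (S t v) w = ip v (S t w))
    (hbdd : ∀ v : V, ∃ M : ℝ, ∀ t : ℝ, 0 ≤ t → (ip (S t v) (S t v)).re ≤ M) (v w : V) :
    ∃ L : ℂ, Tendsto (fun t : ℝ => ip v (S t w)) atTop (𝓝 L) := by
  letI core : PreInnerProductSpace.Core ℂ V :=
    { inner := ip
      conj_inner_symm := h_conj
      re_inner_nonneg := fun x => by rw [RCLike.re_to_complex]; exact h_nonneg x
      add_left := h_add
      smul_left := h_smul }
  letI : SeminormedAddCommGroup V :=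
    @InnerProductSpace.Core.toSeminormedAddCommGroup ℂ V _ _ _ core
  letI : InnerProductSpace ℂ V := InnerProductSpace.ofCore core
  have hinner : ∀ x y : V, ⟪x, y⟫_ℂ = ip x y := fun x y => rfl
  have hnorm : ∀ x : V, ‖x‖ = √(RCLike.re (ip x x)) := fun x => rfl
  have hsymm' : ∀ t : ℝ, 0 ≤ t → ∀ x y : V, ⟪S t x, y⟫_ℂ = ⟪x, S t y⟫_ℂ := by
    intro t ht x y
    rw [hinner, hinner]
    exact hsymm t ht x y
  have hbdd' : ∀ x : V, ∃ M : ℝ, ∀ t : ℝ, 0 ≤ t → ‖S t x‖ ≤ M := by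
    intro x
    obtain ⟨M, hM⟩ := hbdd x
    refine ⟨√M, fun t ht => ?_⟩
    rw [hnorm, RCLike.re_to_complex]
    exact Real.sqrt_le_sqrt (hM t ht)
  obtain ⟨L, hL⟩ := exists_tendsto_inner_semigroup (𝕜 := ℂ) S hS hsymm' hbdd' v w
  exact ⟨L, by simpa only [hinner] using hL⟩

end FormSemigroup

/-! ### Configuration-space identities for time reflection and time translation -/

section Config

variable (d)

/-- On configurations, `T_{-t} ∘ Θ = Θ ∘ T_t`. [folklore] -/
theorem timeShiftField_neg_thetaField (t : ℝ) (ω : FieldConfig (EuclideanSpace ℝ (Fin d))) :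
    timeShiftField d (-t) (thetaField d ω) = thetaField d (timeShiftField d t ω) :=
  (thetaField_timeShiftField d t ω).symm

/-- `Θ (Θ ω) = ω` on configurations. [folklore] -/
@[simp]
theorem thetaField_thetaField (ω : FieldConfig (EuclideanSpace ℝ (Fin d))) :
    thetaField d (thetaField d ω) = ω := by
  ext f
  simp only [thetaField_apply]
  rw [thetaTest_involutive d f]

variable {d}

/-- An OS2-invariant law is invariant under time translations of configurations. [folklore] -/
theorem IsEuclideanInvariantLaw.map_timeShiftField
    {μ : Measure (FieldConfig (EuclideanSpace ℝ (Fin d)))} (h2 : IsEuclideanInvariantLaw μ)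
    (t : ℝ) : μ.map (timeShiftField d t) = μ :=
  IsEuclideanInvariantLaw.isTranslationInvariantLaw_holds h2 _

end Config

/-! ### Formal polynomials in positive-time fields -/

section OSPoly

variable (d) in
/-- Index of a monomial `∏_{j<n} φ(fⱼ)` in positive-time real test functions `fⱼ ∈ 𝒮₊(ℝ^d)`:
a degree `n` and `n` elements of `positiveTimeSubmodule`. [folklore] -/
abbrev PosMonomial : Type := Σ n : ℕ, (Fin n → positiveTimeSubmodule ℝ d)

variable (d) in
/-- Formal polynomials in positive-time fields: finitely supported complex coefficients on
`PosMonomial d` (the polynomial part of Glimm–Jaffe's `𝓔₊`, §6.1, before passing to `L²(dμ)`).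
[cite: GlimmJaffeQP1987, §6.1 (6.1.11)] -/
abbrev OSPoly : Type := PosMonomial d →₀ ℂ

/-- The monomial `ω ↦ ∏ⱼ ω(fⱼ)` (complex-valued). [folklore] -/
def monomialFn {n : ℕ} (f : Fin n → 𝓢(EuclideanSpace ℝ (Fin d), ℝ))
    (ω : FieldConfig (EuclideanSpace ℝ (Fin d))) : ℂ :=
  ∏ j, ((ω (f j) : ℝ) : ℂ)

/-- The monomial attached to an index. [folklore] -/
def posMonomialFn (idx : PosMonomial d) : FieldConfig (EuclideanSpace ℝ (Fin d)) → ℂ :=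
  monomialFn fun j => (idx.2 j : 𝓢(EuclideanSpace ℝ (Fin d), ℝ))

/-- Evaluation of a formal polynomial as a function of the configuration,
`P_v(ω) = ∑ v(n, f) ∏ⱼ ω(fⱼ)` (linear in `v`). [folklore] -/
def polyEval : OSPoly d →ₗ[ℂ] (FieldConfig (EuclideanSpace ℝ (Fin d)) → ℂ) :=
  Finsupp.linearCombination ℂ posMonomialFn

/-- Unfolding: `P_v(ω) = ∑_{idx} v idx · ∏ⱼ ω(fⱼ)`. [folklore] -/
theorem polyEval_apply (v : OSPoly d) (ω : FieldConfig (EuclideanSpace ℝ (Fin d))) :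
    polyEval v ω = v.sum fun idx c => c * posMonomialFn idx ω := by
  have h := Finsupp.apply_linearCombination ℂ (LinearMap.proj ω :
    (FieldConfig (EuclideanSpace ℝ (Fin d)) → ℂ) →ₗ[ℂ] ℂ) (posMonomialFn (d := d)) v
  simp only [LinearMap.coe_proj, Function.eval] at h
  rw [polyEval, h, Finsupp.linearCombination_apply]
  rfl

/-- `P_{c δ_idx} = c · ∏ⱼ ω(fⱼ)`. [folklore] -/
@[simp]
theorem polyEval_single (idx : PosMonomial d) (c : ℂ) :
    polyEval (Finsupp.single idx c) = c • posMonomialFn idx := by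
  simp [polyEval, Finsupp.linearCombination_single]

/-- `P_v` is the field polynomial (in the sense of `fieldPolynomial`) indexed by the support
of `v`. [folklore] -/
theorem polyEval_eq_fieldPolynomial (v : OSPoly d) :
    polyEval v = fieldPolynomial (ι := v.support) (fun i => v i.1)
      (fun i j => ((i.1.2 j : positiveTimeSubmodule ℝ d) : 𝓢(EuclideanSpace ℝ (Fin d), ℝ))) := by
  funext ω
  rw [polyEval_apply, fieldPolynomial, Finsupp.sum, ← Finset.sum_coe_sort]
  rfl

/-- `P_v` is continuous on configurations (weak-* topology). [folklore] -/
theorem continuous_polyEval (v : OSPoly d) : Continuous (polyEval v) := by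
  rw [polyEval_eq_fieldPolynomial]
  exact continuous_fieldPolynomial _ _

omit [NeZero d] in
/-- Monomials are square integrable under `HasAllMoments` (`|∏ⱼ ω(fⱼ)|²` is dominated by
moments, `integrable_absPolynomial_sq`). [folklore] -/
theorem HasAllMoments.memLp_two_monomialFn
    {μ : Measure (FieldConfig (EuclideanSpace ℝ (Fin d)))} [IsFiniteMeasure μ]
    (hμ : HasAllMoments μ) {n : ℕ} (f : Fin n → 𝓢(EuclideanSpace ℝ (Fin d), ℝ)) :
    MemLp (monomialFn f) 2 μ := by
  have hmeas : AEStronglyMeasurable (monomialFn f) μ := (continuous_monomial f).aestronglyMeasurable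
  rw [memLp_two_iff_integrable_sq_norm hmeas]
  have h := integrable_absPolynomial_sq hμ (ι := Unit) (m := fun _ => n) (fun _ => (1 : ℂ))
    (fun _ j => f j)
  refine h.congr (ae_of_all _ fun ω => ?_)
  simp only [absPolynomial, Finset.univ_unique, Finset.sum_singleton, norm_one, one_mul,
    monomialFn, norm_prod, Complex.norm_real, Real.norm_eq_abs]

/-- `P_v ∈ L²(dμ)` under `HasAllMoments`. [folklore] -/
theorem HasAllMoments.memLp_two_polyEval
    {μ : Measure (FieldConfig (EuclideanSpace ℝ (Fin d)))} [IsFiniteMeasure μ]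
    (hμ : HasAllMoments μ) (v : OSPoly d) : MemLp (polyEval v) 2 μ := by
  have : polyEval v = fun ω => ∑ idx ∈ v.support, v idx * posMonomialFn idx ω := by
    funext ω; rw [polyEval_apply, Finsupp.sum]
  rw [this]
  exact memLp_finsetSum _ fun idx _ => (hμ.memLp_two_monomialFn _).const_mul _

end OSPoly

/-! ### Time translation of formal polynomials -/

section Shift

/-- Forward time translation of a monomial index by `max t 0` (so that positive time support is
preserved; only `t ≥ 0` matters). [folklore] -/
def shiftMonomial (t : ℝ) (idx : PosMonomial d) : PosMonomial d :=
  ⟨idx.1, fun j => ⟨timeShiftTest d (max t 0) (idx.2 j : 𝓢(EuclideanSpace ℝ (Fin d), ℝ)),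
    IsPositiveTime.timeShiftTest_holds (idx.2 j).2 (le_max_right t 0)⟩⟩

/-- Time translation of formal polynomials, `T_t (∑ c ∏ φ(fⱼ)) = ∑ c ∏ φ(fⱼ(· - t e₀))`
(Glimm–Jaffe §6.1, `T(t)` on `𝓔₊`). [cite: GlimmJaffeQP1987, §6.1 Thm 6.1.3] -/
def polyShift (t : ℝ) : OSPoly d →ₗ[ℂ] OSPoly d :=
  Finsupp.lmapDomain ℂ ℂ (shiftMonomial t)

/-- Additivity of the index shift for `s, t ≥ 0`. [folklore] -/
theorem shiftMonomial_add {s t : ℝ} (hs : 0 ≤ s) (ht : 0 ≤ t) :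
    shiftMonomial (d := d) (s + t) = shiftMonomial s ∘ shiftMonomial t := by
  funext idx
  rcases idx with ⟨n, f⟩
  simp only [shiftMonomial, Function.comp_apply, max_eq_left hs, max_eq_left ht,
    max_eq_left (add_nonneg hs ht)]
  congr 1
  funext j
  exact Subtype.ext (timeShiftTest_add d s t _)

/-- Semigroup law `T_{s+t} = T_s T_t` (`s, t ≥ 0`). [folklore] -/
theorem polyShift_add {s t : ℝ} (hs : 0 ≤ s) (ht : 0 ≤ t) :
    polyShift (d := d) (s + t) = polyShift s ∘ₗ polyShift t := by
  rw [polyShift, shiftMonomial_add hs ht, Finsupp.lmapDomain_comp]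
  rfl

/-- A shifted monomial is the monomial evaluated on the shifted configuration:
`∏ⱼ ω(fⱼ(· - t e₀)) = ∏ⱼ (T_{-t} ω)(fⱼ)`. [folklore] -/
theorem posMonomialFn_shiftMonomial (t : ℝ) (idx : PosMonomial d)
    (ω : FieldConfig (EuclideanSpace ℝ (Fin d))) :
    posMonomialFn (shiftMonomial t idx) ω = posMonomialFn idx (timeShiftField d (-max t 0) ω) := by
  simp only [posMonomialFn, monomialFn, shiftMonomial, timeShiftField_apply, neg_neg]
  rfl

/-- `P_{T_t v}(ω) = P_v(ω ∘ T_t) = P_v(timeShiftField (-t) ω)`. [folklore] -/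
theorem polyEval_polyShift (t : ℝ) (v : OSPoly d) (ω : FieldConfig (EuclideanSpace ℝ (Fin d))) :
    polyEval (polyShift t v) ω = polyEval v (timeShiftField d (-max t 0) ω) := by
  rw [polyEval_apply, polyEval_apply, polyShift, Finsupp.lmapDomain_apply,
    Finsupp.sum_mapDomain_index (fun _ => by simp) (fun _ _ _ => by rw [add_mul])]
  simp only [posMonomialFn_shiftMonomial]

end Shift

/-! ### The Osterwalder–Schrader form on formal polynomials -/

section Form

variable (μ : Measure (FieldConfig (EuclideanSpace ℝ (Fin d))))

/-- The OS form `b(v, w) = ∫ conj (P_v(θω)) P_w(ω) dμ(ω)` on formal positive-time polynomials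
(Glimm–Jaffe §6.1, (6.1.11): `b(A, B) = ⟨θA, B⟩_{L²}`). [cite: GlimmJaffeQP1987, §6.1 (6.1.11)] -/
def polyForm (v w : OSPoly d) : ℂ :=
  ∫ ω, conj (polyEval v (thetaField d ω)) * polyEval w ω ∂μ

variable {μ}

/-- Continuity of `ω ↦ P_v(Θ ω)`. [folklore] -/
theorem continuous_polyEval_thetaField (v : OSPoly d) :
    Continuous fun ω => polyEval v (thetaField d ω) :=
  (continuous_polyEval v).comp (thetaField d).continuous

section Integrable

variable [IsFiniteMeasure μ]

/-- `P_v ∘ Θ ∈ L²(dμ)` (all moments and `Θ`-invariance of `μ`). [folklore] -/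
theorem HasAllMoments.memLp_two_polyEval_thetaField (hμ : HasAllMoments μ)
    (h2 : IsEuclideanInvariantLaw μ) (v : OSPoly d) :
    MemLp (fun ω => polyEval v (thetaField d ω)) 2 μ :=
  memLp_comp_of_map_eq (thetaField d).continuous.measurable h2.isTimeReflectionInvariantLaw
    (hμ.memLp_two_polyEval v)

/-- The integrand of the OS form is integrable (product of two `L²` functions). [folklore] -/
theorem HasAllMoments.integrable_polyForm (hμ : HasAllMoments μ) (h2 : IsEuclideanInvariantLaw μ)
    (v w : OSPoly d) :
    Integrable (fun ω => conj (polyEval v (thetaField d ω)) * polyEval w ω) μ := by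
  have hA : MemLp (fun ω => conj (polyEval v (thetaField d ω))) 2 μ := by
    have h := hμ.memLp_two_polyEval_thetaField h2 v
    exact ⟨(continuous_conj.comp (continuous_polyEval_thetaField v)).aestronglyMeasurable,
      by rw [eLpNorm_congr_norm_ae (ae_of_all _ fun ω => RCLike.norm_conj _)]; exact h.2⟩
  exact hA.integrable_mul (hμ.memLp_two_polyEval w)

/-- Additivity of the OS form in the first argument. [folklore] -/
theorem polyForm_add_left (hμ : HasAllMoments μ) (h2 : IsEuclideanInvariantLaw μ)
    (v v' w : OSPoly d) : polyForm μ (v + v') w = polyForm μ v w + polyForm μ v' w := by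
  simp only [polyForm, map_add, Pi.add_apply, add_mul]
  exact integral_add (hμ.integrable_polyForm h2 v w) (hμ.integrable_polyForm h2 v' w)

/-- Additivity of the OS form in the second argument. [folklore] -/
theorem polyForm_add_right (hμ : HasAllMoments μ) (h2 : IsEuclideanInvariantLaw μ)
    (v w w' : OSPoly d) : polyForm μ v (w + w') = polyForm μ v w + polyForm μ v w' := by
  simp only [polyForm, map_add, Pi.add_apply, mul_add]
  exact integral_add (hμ.integrable_polyForm h2 v w) (hμ.integrable_polyForm h2 v w')

omit [IsFiniteMeasure μ] in
/-- Conjugate homogeneity of the OS form in the first argument. [folklore] -/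
theorem polyForm_smul_left (c : ℂ) (v w : OSPoly d) :
    polyForm μ (c • v) w = conj c * polyForm μ v w := by
  simp only [polyForm, map_smul, Pi.smul_apply, smul_eq_mul, map_mul, mul_assoc]
  exact integral_const_mul _ _

omit [IsFiniteMeasure μ] in
/-- Homogeneity of the OS form in the second argument. [folklore] -/
theorem polyForm_smul_right (c : ℂ) (v w : OSPoly d) :
    polyForm μ v (c • w) = c * polyForm μ v w := by
  simp only [polyForm, map_smul, Pi.smul_apply, smul_eq_mul]
  rw [← integral_const_mul]
  congr 1; funext ω; ring

/-- Finite additivity of the OS form in the first argument. [folklore] -/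
theorem polyForm_sum_left (hμ : HasAllMoments μ) (h2 : IsEuclideanInvariantLaw μ)
    {ι : Type*} (s : Finset ι) (v : ι → OSPoly d) (w : OSPoly d) :
    polyForm μ (∑ i ∈ s, v i) w = ∑ i ∈ s, polyForm μ (v i) w := by
  classical
  induction s using Finset.induction_on with
  | empty => simp [polyForm]
  | insert a s ha ih => rw [Finset.sum_insert ha, Finset.sum_insert ha, polyForm_add_left hμ h2, ih]

/-- Finite additivity of the OS form in the second argument. [folklore] -/
theorem polyForm_sum_right (hμ : HasAllMoments μ) (h2 : IsEuclideanInvariantLaw μ)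
    {ι : Type*} (s : Finset ι) (v : OSPoly d) (w : ι → OSPoly d) :
    polyForm μ v (∑ i ∈ s, w i) = ∑ i ∈ s, polyForm μ v (w i) := by
  classical
  induction s using Finset.induction_on with
  | empty => simp [polyForm]
  | insert a s ha ih => rw [Finset.sum_insert ha, Finset.sum_insert ha, polyForm_add_right hμ h2, ih]

/-- Expansion of the OS form over the supports:
`b(v, w) = ∑_{i ∈ supp v} ∑_{k ∈ supp w} conj (v i) w k · b(δᵢ, δₖ)`. [folklore] -/
theorem polyForm_eq_sum_sum (hμ : HasAllMoments μ) (h2 : IsEuclideanInvariantLaw μ)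
    (v w : OSPoly d) :
    polyForm μ v w = ∑ i ∈ v.support, ∑ k ∈ w.support,
      conj (v i) * w k * polyForm μ (Finsupp.single i 1) (Finsupp.single k 1) := by
  conv_lhs => rw [← Finsupp.sum_single v, ← Finsupp.sum_single w]
  rw [Finsupp.sum, polyForm_sum_left hμ h2]
  refine Finset.sum_congr rfl fun i _ => ?_
  rw [Finsupp.sum, polyForm_sum_right hμ h2]
  refine Finset.sum_congr rfl fun k _ => ?_
  rw [show Finsupp.single i (v i) = v i • Finsupp.single i (1 : ℂ) by
      rw [Finsupp.smul_single, smul_eq_mul, mul_one],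
    show Finsupp.single k (w k) = w k • Finsupp.single k (1 : ℂ) by
      rw [Finsupp.smul_single, smul_eq_mul, mul_one],
    polyForm_smul_left, polyForm_smul_right, mul_assoc]

end Integrable

/-- The OS form of two monomials is a moment:
`b(δ_{(n,f)}, δ_{(m,g)}) = ∫ (∏ⱼ ω(θfⱼ)) (∏ₗ ω(gₗ)) dμ`. [folklore] -/
theorem polyForm_single_single (i k : PosMonomial d) :
    polyForm μ (Finsupp.single i 1) (Finsupp.single k 1) =
      ∫ ω, (∏ j, ((ω (thetaTest d (i.2 j : 𝓢(EuclideanSpace ℝ (Fin d), ℝ))) : ℝ) : ℂ)) *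
        ∏ l, ((ω (k.2 l : 𝓢(EuclideanSpace ℝ (Fin d), ℝ)) : ℝ) : ℂ) ∂μ := by
  simp only [polyForm, polyEval_single, one_smul, posMonomialFn, monomialFn, thetaField_apply,
    map_prod, Complex.conj_ofReal]

/-- **Hermitian symmetry of the OS form**, from `Θ`-invariance of `μ` and `Θ² = 1`. [folklore] -/
theorem polyForm_conj_symm (h2 : IsEuclideanInvariantLaw μ) (v w : OSPoly d) :
    conj (polyForm μ w v) = polyForm μ v w := by
  rw [polyForm, polyForm, ← integral_conj]
  simp only [map_mul, RingHomCompTriple.comp_apply, RingHom.id_apply]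
  have hg : AEStronglyMeasurable
      (fun ω => conj (polyEval v (thetaField d ω)) * polyEval w ω) μ :=
    ((continuous_conj.comp (continuous_polyEval_thetaField v)).mul
      (continuous_polyEval w)).aestronglyMeasurable
  rw [← integral_comp_eq_of_map_eq (thetaField d).continuous.measurable
    h2.isTimeReflectionInvariantLaw hg]
  congr 1
  funext ω
  simp only [thetaField_thetaField]
  ring

/-- **Positivity of the OS form** (OS3 for field polynomials,
`IsOS3ReflectionPositive.fieldPolynomial_nonneg`). [cite: GlimmJaffeQP1987, §6.1 (6.1.8)] -/
theorem re_polyForm_self_nonneg [IsFiniteMeasure μ] (h3 : IsOS3ReflectionPositive d μ) (hμ : HasAllMoments μ)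
    (v : OSPoly d) : 0 ≤ (polyForm μ v v).re := by
  have h := h3.fieldPolynomial_nonneg hμ (ι := v.support) (fun i => v i.1)
    (fun i j => ((i.1.2 j : positiveTimeSubmodule ℝ d) : 𝓢(EuclideanSpace ℝ (Fin d), ℝ)))
    (fun i j => (i.1.2 j).2)
  rw [polyForm, polyEval_eq_fieldPolynomial]
  exact h.1

/-- **Symmetry of time translation for the OS form** (`t ≥ 0`):
`b(T_t v, w) = b(v, T_t w)`, from `T_{-t} Θ = Θ T_t` and time-translation invariance of `μ`
(Glimm–Jaffe Thm 6.1.3 (ii)). [cite: GlimmJaffeQP1987, Thm 6.1.3 (ii)] -/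
theorem polyForm_polyShift_left (h2 : IsEuclideanInvariantLaw μ) {t : ℝ} (ht : 0 ≤ t)
    (v w : OSPoly d) : polyForm μ (polyShift t v) w = polyForm μ v (polyShift t w) := by
  simp only [polyForm, polyEval_polyShift, max_eq_left ht, timeShiftField_neg_thetaField]
  set g : FieldConfig (EuclideanSpace ℝ (Fin d)) → ℂ := fun ω =>
    conj (polyEval v (thetaField d ω)) * polyEval w (timeShiftField d (-t) ω)
  have hg : AEStronglyMeasurable g μ :=
    ((continuous_conj.comp (continuous_polyEval_thetaField v)).mul
      ((continuous_polyEval w).comp (timeShiftField d (-t)).continuous)).aestronglyMeasurable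
  have h := integral_comp_eq_of_map_eq (timeShiftField d t).continuous.measurable
    (h2.map_timeShiftField t) hg
  simp only [g, timeShiftField_neg_apply'] at h
  exact h

/-- The time-shifted form as a correlation along the flow:
`b(v, T_t w) = ∫ conj (F (T_t ω)) P_w(ω) dμ` with `F = P_v ∘ Θ` (`t ≥ 0`). [folklore] -/
theorem polyForm_polyShift_eq_integral (h2 : IsEuclideanInvariantLaw μ) {t : ℝ} (ht : 0 ≤ t)
    (v w : OSPoly d) :
    polyForm μ v (polyShift t w) =
      ∫ ω, conj (polyEval v (thetaField d (timeShiftField d t ω))) * polyEval w ω ∂μ := by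
  rw [← polyForm_polyShift_left h2 ht]
  simp only [polyForm, polyEval_polyShift, max_eq_left ht, timeShiftField_neg_thetaField]

/-- **Bounded orbits**: `re b(T_t v, T_t v) ≤ ∫ |P_v|² dμ` (Cauchy–Schwarz in `L²(dμ)` and
invariance of `μ` under `Θ` and `T_t`). [folklore] -/
theorem re_polyForm_polyShift_self_le [IsFiniteMeasure μ] (hμ : HasAllMoments μ) (h2 : IsEuclideanInvariantLaw μ)
    (t : ℝ) (v : OSPoly d) :
    (polyForm μ (polyShift t v) (polyShift t v)).re ≤ ∫ ω, ‖polyEval v ω‖ ^ 2 ∂μ := by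
  set s := max t 0
  have hθ := h2.isTimeReflectionInvariantLaw
  have hmθ := (thetaField d).continuous.measurable
  have hmT : ∀ r : ℝ, Measurable (timeShiftField d r) := fun r => (timeShiftField d r).continuous.measurable
  -- the two factors
  set A : FieldConfig (EuclideanSpace ℝ (Fin d)) → ℂ := fun ω =>
    conj (polyEval v (timeShiftField d (-s) (thetaField d ω)))
  set B : FieldConfig (EuclideanSpace ℝ (Fin d)) → ℂ := fun ω =>
    polyEval v (timeShiftField d (-s) ω)
  have hB : MemLp B 2 μ := memLp_comp_of_map_eq (hmT _) (h2.map_timeShiftField _) (hμ.memLp_two_polyEval v)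
  have hA0 : MemLp (fun ω => polyEval v (timeShiftField d (-s) (thetaField d ω))) 2 μ :=
    memLp_comp_of_map_eq (g := B) hmθ hθ hB
  have hA : MemLp A 2 μ :=
    ⟨(continuous_conj.comp ((continuous_polyEval v).comp ((timeShiftField d (-s)).continuous.comp
      (thetaField d).continuous))).aestronglyMeasurable,
      by rw [eLpNorm_congr_norm_ae (ae_of_all _ fun ω => RCLike.norm_conj _)]; exact hA0.2⟩
  have hform : polyForm μ (polyShift t v) (polyShift t v) = ∫ ω, A ω * B ω ∂μ := by
    simp only [polyForm, polyEval_polyShift, A, B, s]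
  -- the two `L²` norms are that of `P_v`
  have hIB : ∫ ω, ‖B ω‖ ^ 2 ∂μ = ∫ ω, ‖polyEval v ω‖ ^ 2 ∂μ := by
    have hg : AEStronglyMeasurable (fun ω => ((‖polyEval v ω‖ ^ 2 : ℝ) : ℂ)) μ :=
      (continuous_ofReal.comp ((continuous_polyEval v).norm.pow 2)).aestronglyMeasurable
    have h := integral_comp_eq_of_map_eq (hmT (-s)) (h2.map_timeShiftField _) hg
    have h' : ∫ ω, ((‖B ω‖ ^ 2 : ℝ) : ℂ) ∂μ = ∫ ω, ((‖polyEval v ω‖ ^ 2 : ℝ) : ℂ) ∂μ := h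
    rw [integral_complex_ofReal, integral_complex_ofReal] at h'
    exact_mod_cast h'
  have hIA : ∫ ω, ‖A ω‖ ^ 2 ∂μ = ∫ ω, ‖polyEval v ω‖ ^ 2 ∂μ := by
    have hg : AEStronglyMeasurable (fun ω => ((‖B ω‖ ^ 2 : ℝ) : ℂ)) μ :=
      (continuous_ofReal.comp (((continuous_polyEval v).comp
        (timeShiftField d (-s)).continuous).norm.pow 2)).aestronglyMeasurable
    have h := integral_comp_eq_of_map_eq hmθ hθ hg
    have h' : ∫ ω, ((‖B (thetaField d ω)‖ ^ 2 : ℝ) : ℂ) ∂μ = ∫ ω, ((‖B ω‖ ^ 2 : ℝ) : ℂ) ∂μ := h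
    rw [integral_complex_ofReal, integral_complex_ofReal] at h'
    have h'' : ∫ ω, ‖B (thetaField d ω)‖ ^ 2 ∂μ = ∫ ω, ‖B ω‖ ^ 2 ∂μ := by exact_mod_cast h'
    rw [← hIB, ← h'']
    simp only [A, B, RCLike.norm_conj]
  rw [hform]
  refine (Complex.re_le_norm _).trans ((norm_integral_mul_le_sqrt hA hB).trans ?_)
  rw [hIA, hIB, ← pow_two, Real.sq_sqrt (integral_nonneg fun ω => by positivity)]

end Form

/-! ### Convergence of the time-shifted OS form (Glimm–Jaffe Thm 19.7.1) -/

section Cluster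

variable {μ : Measure (FieldConfig (EuclideanSpace ℝ (Fin d)))}

/-- **Existence of the limit** `lim_{t → ∞} b(v, T_t w)`: the time translations form a symmetric
semigroup with bounded orbits on the OS pre-Hilbert space `(OSPoly, b)` (positivity of `b` is
OS3 for polynomials), so `exists_tendsto_inner_semigroup` (Glimm–Jaffe Thm 6.1.3 (iii) and
p. 315) applies. [cite: GlimmJaffeQP1987, Thm 6.1.3 and Thm 19.7.1] -/
theorem exists_tendsto_polyForm_polyShift (hμ : IsOSMeasure d μ) (v w : OSPoly d) :
    ∃ L : ℂ, Tendsto (fun t : ℝ => polyForm μ v (polyShift t w)) atTop (𝓝 L) := by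
  haveI := hμ.isProbabilityMeasure
  have hall : HasAllMoments μ := hμ.hasAllMoments
  have h2 : IsEuclideanInvariantLaw μ := hμ.os2
  refine exists_tendsto_form_semigroup (polyForm μ) (fun x y => polyForm_conj_symm h2 x y)
    (fun x => re_polyForm_self_nonneg hμ.os3 hall x) (fun x y z => polyForm_add_left hall h2 x y z)
    (fun x y r => polyForm_smul_left r x y) (fun t => polyShift t)
    (fun s t hs ht => polyShift_add hs ht) (fun t ht x y => polyForm_polyShift_left h2 ht x y)
    (fun x => ⟨∫ ω, ‖polyEval x ω‖ ^ 2 ∂μ, fun t _ => re_polyForm_polyShift_self_le hall h2 t x⟩)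
    v w

/-- The OS form against a single monomial on the right. [folklore] -/
theorem polyForm_right_single [IsFiniteMeasure μ] (hμ : HasAllMoments μ)
    (h2 : IsEuclideanInvariantLaw μ) (v : OSPoly d) (k : PosMonomial d) :
    polyForm μ v (Finsupp.single k 1) =
      ∑ i ∈ v.support, conj (v i) * polyForm μ (Finsupp.single i 1) (Finsupp.single k 1) := by
  rw [polyForm_eq_sum_sum hμ h2]
  refine Finset.sum_congr rfl fun i _ => ?_
  rw [Finsupp.support_single k one_ne_zero, Finset.sum_singleton, Finsupp.single_eq_same,
    mul_one]

/-- Expansion of the time-shifted form over monomials: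
`b(v, T_t w) = ∑ₖ ∑ᵢ w k · conj (v i) · b(δᵢ, δ_{T_t k})`. [folklore] -/
theorem polyForm_polyShift_eq_sum [IsFiniteMeasure μ] (hμ : HasAllMoments μ)
    (h2 : IsEuclideanInvariantLaw μ) (v w : OSPoly d) (t : ℝ) :
    polyForm μ v (polyShift t w) = ∑ k ∈ w.support, ∑ i ∈ v.support,
      w k * (conj (v i) *
        polyForm μ (Finsupp.single i 1) (Finsupp.single (shiftMonomial t k) 1)) := by
  have hw : polyShift t w = ∑ k ∈ w.support, w k • Finsupp.single (shiftMonomial t k) (1 : ℂ) := by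
    conv_lhs => rw [← Finsupp.sum_single w, Finsupp.sum, map_sum]
    refine Finset.sum_congr rfl fun k _ => ?_
    rw [polyShift, Finsupp.lmapDomain_apply, Finsupp.mapDomain_single, Finsupp.smul_single,
      smul_eq_mul, mul_one]
  rw [hw, polyForm_sum_right hμ h2]
  refine Finset.sum_congr rfl fun k _ => ?_
  rw [polyForm_smul_right, polyForm_right_single hμ h2, Finset.mul_sum]

/-- The OS form of two monomials as a (real) moment of `μ` in the appended family
`(θf₁, …, θfₙ, g₁, …, gₘ)`. [folklore] -/
theorem polyForm_single_single_eq_moment (i k : PosMonomial d) :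
    polyForm μ (Finsupp.single i 1) (Finsupp.single k 1) =
      ((moment μ (i.1 + k.1) (Fin.append
        (fun j => thetaTest d (i.2 j : 𝓢(EuclideanSpace ℝ (Fin d), ℝ)))
        (fun l => (k.2 l : 𝓢(EuclideanSpace ℝ (Fin d), ℝ)))) : ℝ) : ℂ) := by
  rw [polyForm_single_single, moment, ← integral_complex_ofReal]
  refine integral_congr_ae (ae_of_all _ fun ω => ?_)
  simp only [Fin.prod_univ_add, Fin.append_left, Fin.append_right, Complex.ofReal_mul,
    Complex.ofReal_prod]

/-- Continuity of `t ↦ b(v, T_t w)` (from the joint continuity of the moments, `hcont`, and of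
`t ↦ fⱼ(· - t e₀)` in `𝓢`). [folklore] -/
theorem continuous_polyForm_polyShift [IsFiniteMeasure μ] (hμ : HasAllMoments μ)
    (h2 : IsEuclideanInvariantLaw μ)
    (hcont : ∀ n : ℕ, Continuous fun f : Fin n → 𝓢(EuclideanSpace ℝ (Fin d), ℝ) => moment μ n f)
    (v w : OSPoly d) : Continuous fun t : ℝ => polyForm μ v (polyShift t w) := by
  simp only [polyForm_polyShift_eq_sum hμ h2, polyForm_single_single_eq_moment, shiftMonomial]
  refine continuous_finsetSum _ fun k _ => continuous_finsetSum _ fun i _ =>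
    continuous_const.mul (continuous_const.mul (Complex.continuous_ofReal.comp
      ((hcont (i.1 + k.1)).comp (continuous_pi fun idx => ?_))))
  refine Fin.addCases (fun j => ?_) (fun l => ?_) idx
  · simp only [Fin.append_left]
    exact continuous_const
  · simp only [Fin.append_right]
    exact (continuous_timeShiftTest d _).comp (continuous_id.max continuous_const)

/-- The observable `F = P_v ∘ Θ` evaluated along the time flow, as an explicit finite sum. [folklore] -/
theorem polyEval_thetaField_timeShiftField (v : OSPoly d) (t : ℝ)
    (ω : FieldConfig (EuclideanSpace ℝ (Fin d))) :
    polyEval v (thetaField d (timeShiftField d t ω)) =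
      ∑ i ∈ v.support, v i * ∏ j, ((ω (timeShiftTest d (-t)
        (thetaTest d (i.2 j : 𝓢(EuclideanSpace ℝ (Fin d), ℝ)))) : ℝ) : ℂ) := by
  simp only [polyEval_apply, Finsupp.sum, posMonomialFn, monomialFn, thetaField_apply,
    timeShiftField_apply]

/-- Continuity of `t ↦ F (T_t ω)` for each configuration `ω`. [folklore] -/
theorem continuous_polyEval_flow (v : OSPoly d) (ω : FieldConfig (EuclideanSpace ℝ (Fin d))) :
    Continuous fun t : ℝ => polyEval v (thetaField d (timeShiftField d t ω)) := by
  simp only [polyEval_thetaField_timeShiftField]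
  refine continuous_finsetSum _ fun i _ => continuous_const.mul
    (continuous_finsetProd _ fun j _ => Complex.continuous_ofReal.comp ?_)
  exact (ω.continuous.comp ((continuous_timeShiftTest d _).comp continuous_neg))

/-- Invariance of the `L²` norm of `P_v` along `Θ ∘ T_t`. [folklore] -/
theorem integral_norm_sq_polyEval_flow [IsFiniteMeasure μ] (h2 : IsEuclideanInvariantLaw μ)
    (v : OSPoly d) (t : ℝ) :
    ∫ ω, ‖polyEval v (thetaField d (timeShiftField d t ω))‖ ^ 2 ∂μ =
      ∫ ω, ‖polyEval v ω‖ ^ 2 ∂μ := by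
  have hg : AEStronglyMeasurable (fun ω => ‖polyEval v (thetaField d ω)‖ ^ 2) μ :=
    ((continuous_polyEval_thetaField v).norm.pow 2).aestronglyMeasurable
  have hg' : AEStronglyMeasurable (fun ω => ‖polyEval v ω‖ ^ 2) μ :=
    ((continuous_polyEval v).norm.pow 2).aestronglyMeasurable
  rw [integral_comp_eq_of_map_eq (timeShiftField d t).continuous.measurable
    (h2.map_timeShiftField t) hg,
    integral_comp_eq_of_map_eq (thetaField d).continuous.measurable
    h2.isTimeReflectionInvariantLaw hg']

/-- Joint (strong) measurability of `(t, ω) ↦ conj (F(T_t ω)) P_w(ω)` on `ℝ × 𝒮'`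
(continuous in `t`, continuous in `ω`). [folklore] -/
theorem stronglyMeasurable_flow_integrand (v w : OSPoly d) :
    StronglyMeasurable (Function.uncurry fun (t : ℝ) (ω : FieldConfig (EuclideanSpace ℝ (Fin d))) =>
      conj (polyEval v (thetaField d (timeShiftField d t ω))) * polyEval w ω) := by
  refine stronglyMeasurable_uncurry_of_continuous_of_stronglyMeasurable (fun ω => ?_) (fun t => ?_)
  · exact (continuous_conj.comp (continuous_polyEval_flow v ω)).mul continuous_const
  · exact ((continuous_conj.comp ((continuous_polyEval_thetaField v).comp
      (timeShiftField d t).continuous)).mul (continuous_polyEval w)).stronglyMeasurable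

/-- **Cesàro means of the correlation are paired time averages** (Fubini): for `T ≥ 0`,
`∫₀ᵀ b(v, T_t w) dt = ∫ conj (∫₀ᵀ F(T_t ω) dt) P_w(ω) dμ(ω)`, `F = P_v ∘ Θ`
(Glimm–Jaffe (6.1.10), (19.7.1)). [cite: GlimmJaffeQP1987, Thm 19.7.1 (proof)] -/
theorem integral_polyForm_polyShift_eq (hμ : IsOSMeasure d μ) (v w : OSPoly d) {T : ℝ}
    (hT : 0 ≤ T) :
    ∫ t in (0 : ℝ)..T, polyForm μ v (polyShift t w) =
      ∫ ω, conj (∫ t in (0 : ℝ)..T, polyEval v (thetaField d (timeShiftField d t ω))) *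
        polyEval w ω ∂μ := by
  haveI := hμ.isProbabilityMeasure
  have hall : HasAllMoments μ := hμ.hasAllMoments
  have h2 : IsEuclideanInvariantLaw μ := hμ.os2
  set f : ℝ → FieldConfig (EuclideanSpace ℝ (Fin d)) → ℂ := fun t ω =>
    conj (polyEval v (thetaField d (timeShiftField d t ω))) * polyEval w ω with hf
  simp only [intervalIntegral.integral_of_le hT]
  rw [setIntegral_congr_fun measurableSet_Ioc
    (fun t ht => polyForm_polyShift_eq_integral h2 ht.1.le v w)]
  -- integrability on the product
  have hmeas := stronglyMeasurable_flow_integrand v w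
  have hint : Integrable (Function.uncurry f) ((volume.restrict (Ioc 0 T)).prod μ) := by
    rw [integrable_prod_iff hmeas.aestronglyMeasurable]
    constructor
    · refine ae_of_all _ fun t => ?_
      have hA : MemLp (fun ω => conj (polyEval v (thetaField d (timeShiftField d t ω)))) 2 μ := by
        have h := memLp_comp_of_map_eq (timeShiftField d t).continuous.measurable
          (h2.map_timeShiftField t) (hall.memLp_two_polyEval_thetaField h2 v)
        exact ⟨(continuous_conj.comp ((continuous_polyEval_thetaField v).comp
          (timeShiftField d t).continuous)).aestronglyMeasurable,
          by rw [eLpNorm_congr_norm_ae (ae_of_all _ fun ω => RCLike.norm_conj _)]; exact h.2⟩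
      exact hA.integrable_mul (hall.memLp_two_polyEval w)
    · refine Integrable.of_bound (hmeas.norm.integral_prod_right').aestronglyMeasurable
        (√(∫ ω, ‖polyEval v ω‖ ^ 2 ∂μ) * √(∫ ω, ‖polyEval w ω‖ ^ 2 ∂μ))
        (ae_of_all _ fun t => ?_)
      rw [Real.norm_of_nonneg (integral_nonneg fun ω => norm_nonneg _)]
      have hA : MemLp (fun ω => polyEval v (thetaField d (timeShiftField d t ω))) 2 μ :=
        memLp_comp_of_map_eq (timeShiftField d t).continuous.measurable
          (h2.map_timeShiftField t) (hall.memLp_two_polyEval_thetaField h2 v)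
      have h := integral_norm_mul_norm_le_sqrt hA (hall.memLp_two_polyEval w)
      rw [integral_norm_sq_polyEval_flow h2 v t] at h
      refine le_trans (le_of_eq ?_) h
      refine integral_congr_ae (ae_of_all _ fun ω => ?_)
      simp only [Function.uncurry, norm_mul, RCLike.norm_conj]
  have hswap := integral_integral_swap hint
  simp only [f] at hswap
  rw [hswap]
  refine integral_congr_ae (ae_of_all _ fun ω => ?_)
  simp only
  rw [integral_mul_const, integral_conj]

/-- **Ergodic identification** (OS4): the paired time averages converge,
`∫ conj (A_T(ω)) P_w(ω) dμ → conj (∫ F dμ) ∫ P_w dμ`, where `A_T = T⁻¹ ∫₀ᵀ F ∘ T_t dt → ∫ F dμ`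
in `L²(dμ)` by OS4 (Glimm–Jaffe (6.1.5), (19.7.1)). [cite: GlimmJaffeQP1987, §6.1 (6.1.5) and Thm 19.7.1] -/
theorem tendsto_integral_conj_timeAverage_mul (hμ : IsOSMeasure d μ) (v w : OSPoly d) :
    Tendsto (fun T : ℝ => ∫ ω, conj (timeAverage d T
        (fun ω => polyEval v (thetaField d ω)) ω) * polyEval w ω ∂μ) atTop
      (𝓝 (conj (∫ ω, polyEval v (thetaField d ω) ∂μ) * ∫ ω, polyEval w ω ∂μ)) := by
  haveI := hμ.isProbabilityMeasure
  have hall : HasAllMoments μ := hμ.hasAllMoments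
  have h2 : IsEuclideanInvariantLaw μ := hμ.os2
  set F : FieldConfig (EuclideanSpace ℝ (Fin d)) → ℂ := fun ω => polyEval v (thetaField d ω) with hF
  set m : ℂ := ∫ ω, F ω ∂μ with hm
  set A : ℝ → FieldConfig (EuclideanSpace ℝ (Fin d)) → ℂ := fun T ω => timeAverage d T F ω with hA
  set P := polyEval w with hP
  have hPm : MemLp P 2 μ := hall.memLp_two_polyEval w
  -- OS4
  have hos4 : Tendsto (fun T : ℝ => eLpNorm (fun ω => A T ω - m) 2 μ) atTop (𝓝 0) :=
    hμ.os4 F (hall.memLp_two_polyEval_thetaField h2 v)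
  -- measurability of the time averages (`T ≥ 0`)
  have hmeasA : ∀ T : ℝ, 0 ≤ T → AEStronglyMeasurable (A T) μ := by
    intro T hT
    have hG : StronglyMeasurable (Function.uncurry fun (t : ℝ)
        (ω : FieldConfig (EuclideanSpace ℝ (Fin d))) => F (timeShiftField d t ω)) :=
      stronglyMeasurable_uncurry_of_continuous_of_stronglyMeasurable
        (fun ω => continuous_polyEval_flow v ω)
        (fun t => ((continuous_polyEval_thetaField v).comp
          (timeShiftField d t).continuous).stronglyMeasurable)
    have h := (hG.integral_prod_left' (μ := volume.restrict (Ioc 0 T))).aestronglyMeasurable (μ := μ)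
    have hAeq : A T = fun ω => (T⁻¹ : ℝ) • ∫ t in Ioc 0 T, F (timeShiftField d t ω) := by
      funext ω
      simp only [hA, timeAverage, intervalIntegral.integral_of_le hT]
    rw [hAeq]
    exact h.const_smul (T⁻¹ : ℝ)
  -- the error term tends to zero
  have herr : Tendsto (fun T : ℝ => ∫ ω, conj (A T ω - m) * P ω ∂μ) atTop (𝓝 0) := by
    have hbound : ∀ᶠ T : ℝ in atTop, ‖∫ ω, conj (A T ω - m) * P ω ∂μ‖ₑ ≤
        eLpNorm (fun ω => A T ω - m) 2 μ * eLpNorm P 2 μ := by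
      filter_upwards [eventually_ge_atTop 0] with T hT
      have hAm : AEStronglyMeasurable (fun ω => A T ω - m) μ := (hmeasA T hT).sub aestronglyMeasurable_const
      have h := enorm_integral_mul_le_eLpNorm (continuous_conj.comp_aestronglyMeasurable hAm) hPm.1
      rwa [eLpNorm_congr_norm_ae (ae_of_all _ fun ω => RCLike.norm_conj _)] at h
    have hlim : Tendsto (fun T : ℝ => eLpNorm (fun ω => A T ω - m) 2 μ * eLpNorm P 2 μ) atTop
        (𝓝 0) := by
      have h := ENNReal.Tendsto.mul_const hos4 (Or.inr hPm.2.ne)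
      rwa [zero_mul] at h
    have h0 : Tendsto (fun T : ℝ => ‖∫ ω, conj (A T ω - m) * P ω ∂μ‖ₑ) atTop (𝓝 0) :=
      tendsto_of_tendsto_of_tendsto_of_le_of_le' tendsto_const_nhds hlim
        (Eventually.of_forall fun T => zero_le) hbound
    have h0' : Tendsto (fun T : ℝ => ‖∫ ω, conj (A T ω - m) * P ω ∂μ‖) atTop (𝓝 0) := by
      have := (ENNReal.tendsto_toReal ENNReal.zero_ne_top).comp h0
      simpa only [Function.comp_def, toReal_enorm, ENNReal.toReal_zero] using this
    exact tendsto_zero_iff_norm_tendsto_zero.2 h0'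
  -- eventually the paired average splits as error term + limit
  have hsplit : ∀ᶠ T : ℝ in atTop, ∫ ω, conj (A T ω) * P ω ∂μ =
      ∫ ω, conj (A T ω - m) * P ω ∂μ + conj m * ∫ ω, P ω ∂μ := by
    have hfin : ∀ᶠ T : ℝ in atTop, eLpNorm (fun ω => A T ω - m) 2 μ < 1 :=
      hos4 (Iio_mem_nhds zero_lt_one)
    filter_upwards [hfin, eventually_ge_atTop 0] with T hT hT0
    have hAm : MemLp (fun ω => A T ω - m) 2 μ :=
      ⟨(hmeasA T hT0).sub aestronglyMeasurable_const, hT.trans ENNReal.one_lt_top⟩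
    have hAm' : MemLp (fun ω => conj (A T ω - m)) 2 μ :=
      ⟨continuous_conj.comp_aestronglyMeasurable hAm.1,
        by rw [eLpNorm_congr_norm_ae (ae_of_all _ fun ω => RCLike.norm_conj _)]; exact hAm.2⟩
    have hi1 : Integrable (fun ω => conj (A T ω - m) * P ω) μ := hAm'.integrable_mul hPm
    have hi2 : Integrable (fun ω => conj m * P ω) μ := (hPm.integrable one_le_two).const_mul _
    rw [← integral_const_mul, ← integral_add hi1 hi2]
    refine integral_congr_ae (ae_of_all _ fun ω => ?_)
    simp only [map_sub]
    ring
  have hmain : Tendsto (fun T : ℝ => ∫ ω, conj (A T ω - m) * P ω ∂μ + conj m * ∫ ω, P ω ∂μ)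
      atTop (𝓝 (0 + conj m * ∫ ω, P ω ∂μ)) := herr.add tendsto_const_nhds
  rw [zero_add] at hmain
  exact hmain.congr' (hsplit.mono fun T hT => hT.symm)

/-- **Time clustering of the OS form** (Glimm–Jaffe Thm 19.7.1, OS0–OS4 ⇒ `e^{-tH} → P_Ω`):
for formal positive-time polynomials `v, w`,
`b(v, T_t w) → conj (∫ P_v ∘ Θ dμ) · ∫ P_w dμ = b(v, 1) b(1, w)` as `t → ∞`. The limit exists
by the contraction-semigroup argument (`exists_tendsto_polyForm_polyShift`); it is identified
through its Cesàro means (`tendsto_inv_smul_intervalIntegral`), which are paired time averages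
(`integral_polyForm_polyShift_eq`) converging by OS4 (`tendsto_integral_conj_timeAverage_mul`).
[cite: GlimmJaffeQP1987, Thm 19.7.1] -/
theorem tendsto_polyForm_polyShift (hμ : IsOSMeasure d μ)
    (hcont : ∀ n : ℕ, Continuous fun f : Fin n → 𝓢(EuclideanSpace ℝ (Fin d), ℝ) => moment μ n f)
    (v w : OSPoly d) :
    Tendsto (fun t : ℝ => polyForm μ v (polyShift t w)) atTop
      (𝓝 (conj (∫ ω, polyEval v (thetaField d ω) ∂μ) * ∫ ω, polyEval w ω ∂μ)) := by
  haveI := hμ.isProbabilityMeasure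
  have hall : HasAllMoments μ := hμ.hasAllMoments
  have h2 : IsEuclideanInvariantLaw μ := hμ.os2
  obtain ⟨L, hL⟩ := exists_tendsto_polyForm_polyShift hμ v w
  set c : ℝ → ℂ := fun t => polyForm μ v (polyShift t w) with hc
  have hcc : Continuous c := continuous_polyForm_polyShift hall h2 hcont v w
  have h1 : Tendsto (fun T : ℝ => T⁻¹ • ∫ t in (0 : ℝ)..T, c t) atTop (𝓝 L) :=
    tendsto_inv_smul_intervalIntegral hL fun a b => hcc.intervalIntegrable a b
  have h2' : (fun T : ℝ => T⁻¹ • ∫ t in (0 : ℝ)..T, c t) =ᶠ[atTop] fun T =>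
      ∫ ω, conj (timeAverage d T (fun ω => polyEval v (thetaField d ω)) ω) * polyEval w ω ∂μ := by
    filter_upwards [eventually_ge_atTop 0] with T hT
    simp only [hc]
    rw [integral_polyForm_polyShift_eq hμ v w hT, ← integral_smul (T⁻¹ : ℝ)]
    refine integral_congr_ae (ae_of_all _ fun ω => ?_)
    simp only [timeAverage, Complex.real_smul, map_mul, Complex.conj_ofReal, mul_assoc]
  have h3 := tendsto_integral_conj_timeAverage_mul hμ v w
  have hLeq : L = conj (∫ ω, polyEval v (thetaField d ω) ∂μ) * ∫ ω, polyEval w ω ∂μ :=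
    tendsto_nhds_unique (h1.congr' h2') h3
  rwa [hLeq] at hL

end Cluster

end Literature.MathematicalPhysics.QuantumLattice
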